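import Literature.NumberTheory.LFunctions.ClassGroupLFunctionExceptionalZeroSimple
import HarnessLib

/-!
# Real zeros of `ζ_K` near `1`, and Landau–Page for `ζ_K · ∏_{χ ≠ 1} L(s, χ)`, uniformly in the field

Topic `Literature/NumberTheory/LFunctions` (namespace `Literature.NumberTheory.LFunctions.NumberField`),
completing the uniform results for the class group `L`-functions `L(s, χ)`, `χ ≠ 1`
(`ClassGroupLFunctionZeroFreeRegion.lean`, `ClassGroupLFunctionRealZeros.lean`,
`ClassGroupLFunctionExceptionalZeroSimple.lean`) by the factor `χ = 1`, i.e. `ζ_K`, as far as REAL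
zeros are concerned, for number fields of any degree `n` with constants depending on `n` alone
([ThornerZaman2019, Theorem 3.1]: "`∏_χ L(s, χ, L/K)` has at most one zero in the region … if
`β₁` exists, then it is real and simple"). Everything here is PROVED (theorems only).

The tool is the local partial fraction of `ζ₁_K'/ζ₁_K` at height `0` with true multiplicities
(`DedekindZetaPartialFraction.lean`, Lagarias–Odlyzko Lemma 5.6) and the trivial positivity
`L(Λ_K, σ) = Σ Λ(𝔞) N𝔞^{-σ} ≥ 0`:

* `re_LSeries_vonMangoldtNorm_ofReal_le_of_realZero` — for a real zero `β₀ ∈ [1/16, 1)` of `ζ_K`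
  of order `≥ k`: `L(Λ_K, σ) ≤ 1/(σ − 1) − k/(σ − β₀) + 77760 M_K(0)` (`1 < σ ≤ 2`);
  `re_LSeries_vonMangoldtNorm_ofReal_le_of_two_realZeros` — two distinct real zeros:
  `L(Λ_K, σ) ≤ 1/(σ−1) − 1/(σ−β₀) − 1/(σ−β₁) + 77760 M_K(0)`;
* `exists_min_realZeros_dedekindZeta₁_le` — **at most one real zero of `ζ_K` in
  `σ > 1 − c(n)/(log|d_K| + log 4)`**; `exists_realZero_simple_dedekindZeta₁` — **it is simple**;
* `exists_landau_dedekindZeta₁_classGroupLFunction₀` — **Landau–Page across the family**: a real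
  zero `β₀` of `ζ_K` and a real zero `β` of `L₀(s, χ)`, `χ ≠ 1`, satisfy
  `min(β₀, β) ≤ 1 − c(n)/(log|d_K| + log 4)` (MV Theorem 11.7 with the positivity
  `Σ Λ(𝔞)(1 + Re χ(𝔞)) N𝔞^{-σ} ≥ 0`, i.e. MV (11.4), the zero of `ζ_K` entering through the
  partial fraction and that of `L(s, χ)` through MV (11.2)).

## References

* H. L. Montgomery, R. C. Vaughan, *Multiplicative Number Theory I*, CUP 2007, Theorem 11.3
  (Case 4), Theorem 11.7. [MontgomeryVaughan2007]
* J. C. Lagarias, A. M. Odlyzko, *Effective versions of the Chebotarev density theorem* (1977),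
  Lemma 5.6. [LagariasOdlyzko1977]
* J. Thorner, A. Zaman, *A unified and improved Chebotarev density theorem*, ANT 13 (2019),
  Theorem 3.1. [ThornerZaman2019]
-/

noncomputable section

open scoped NumberField nonZeroDivisors
open Complex Filter Topology Set Metric MeromorphicOn NumberField

namespace Literature.NumberTheory.LFunctions.NumberField

variable {K : Type*} [Field K] [NumberField K]

/-! ### The partial fraction of `ζ₁_K'/ζ₁_K` at height `0`, keeping prescribed real zeros -/

/-- `ζ₁_K` is not locally zero anywhere. [folklore] -/
theorem analyticOrderAt_dedekindZeta₁_ne_top (z : ℂ) : analyticOrderAt (dedekindZeta₁ K) z ≠ ⊤ := by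
  intro htop
  rw [analyticOrderAt_eq_top] at htop
  have han := analyticOnNhd_dedekindZeta₁ K Set.univ
  have hzero := han.eqOn_zero_of_preconnected_of_eventuallyEq_zero isPreconnected_univ
    (Set.mem_univ z) htop (Set.mem_univ (2 : ℂ))
  exact dedekindZeta₁_ne_zero_of_one_le_re (K := K) (s := 2) (by norm_num) hzero

/-- A real zero of `ζ₁_K` (equivalently of `ζ_K`) is `< 1`. [folklore] -/
theorem realZero_dedekindZeta₁_lt_one {β : ℝ} (hβ : dedekindZeta₁ K β = 0) : β < 1 := by
  by_contra h
  exact dedekindZeta₁_ne_zero_of_one_le_re (K := K) (s := β) (by simpa using not_lt.mp h) hβ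

/-- **The Stark-type bound keeping real zeros**: let `T` be a finite set of real numbers in
`[1/16, 1)` with prescribed multiplicities `k(b) ≤ ord_b ζ₁_K`. Then for `1 < σ ≤ 2`,
`L(Λ_K, σ) ≤ 1/(σ − 1) − Σ_{b ∈ T} k(b)/(σ − b) + 77760 M_K(0)`.
[cite: LagariasOdlyzko1977, Lemma 5.6] -/
theorem re_LSeries_vonMangoldtNorm_ofReal_le_of_realZeros (T : Finset ℝ) (k : ℝ → ℕ)
    (hT : ∀ b ∈ T, 1 / 16 ≤ b ∧ b < 1 ∧ (k b : ℕ∞) ≤ analyticOrderAt (dedekindZeta₁ K) b)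
    {σ : ℝ} (hσ : 1 < σ) (hσ2 : σ ≤ 2) :
    (LSeries (fun n ↦ (vonMangoldtNorm K n : ℂ)) σ).re ≤
      1 / (σ - 1) - ∑ b ∈ T, (k b : ℝ) / (σ - b) + 77760 * discBound K 0 := by
  classical
  set f := dedekindZeta₁ K with hf
  have hc2 : (2 : ℂ) + ((0 : ℝ) : ℂ) * I = 2 := by simp
  have hs : 1 < ((σ : ℂ)).re := by simpa using hσ
  have hsc : (σ : ℂ) ∈ closedBall ((2 : ℂ) + ((0 : ℝ) : ℂ) * I) (7 / 4) := by
    rw [mem_closedBall, dist_eq_norm, hc2, show (σ : ℂ) - 2 = ((σ - 2 : ℝ) : ℂ) by push_cast; ring,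
      Complex.norm_real, Real.norm_eq_abs, abs_le]
    constructor <;> linarith
  have hfs : f σ ≠ 0 := dedekindZeta₁_ne_zero_of_one_le_re hs.le
  have hpf := norm_logDeriv_dedekindZeta₁_sub_sum_le K 0 hsc hfs
  set D := divisor f (closedBall ((2 : ℂ) + ((0 : ℝ) : ℂ) * I) (31 / 16)) with hD
  set S := (D.finiteSupport (isCompact_closedBall _ _)).toFinset with hS
  have han := analyticOnNhd_dedekindZeta₁ K (closedBall ((2 : ℂ) + ((0 : ℝ) : ℂ) * I) (31 / 16))
  have hterm_re : ∀ u : ℂ, ((D u : ℂ) / ((σ : ℂ) - u)).re = (D u : ℝ) * (((σ : ℂ) - u)⁻¹).re := fun u ↦ by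
    rw [div_eq_mul_inv, show ((D u : ℤ) : ℂ) = ((D u : ℝ) : ℂ) by simp, Complex.re_ofReal_mul]
  have hDnn : ∀ u, (0 : ℝ) ≤ D u := fun u ↦ by exact_mod_cast han.divisor_nonneg u
  have hinv_nn : ∀ u ∈ S, 0 ≤ (((σ : ℂ) - u)⁻¹).re := by
    intro u hu
    obtain ⟨-, -, -, hu1⟩ := zero_of_mem_support_divisor_bigDisc hu
    rw [Complex.inv_re]
    exact div_nonneg (by simp; linarith) (Complex.normSq_nonneg _)
  have hterm_nn : ∀ u ∈ S, 0 ≤ ((D u : ℂ) / ((σ : ℂ) - u)).re := fun u hu ↦ by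
    rw [hterm_re u]; exact mul_nonneg (hDnn u) (hinv_nn u hu)
  -- the prescribed zeros lie in `S` with multiplicity `≥ k`
  set ι : ℝ → ℂ := fun b ↦ (b : ℂ) with hι
  have hιinj : Set.InjOn ι (T : Set ℝ) := fun a _ b _ h ↦ by
    simp only [hι] at h
    exact_mod_cast h
  have hbB : ∀ b ∈ T, (b : ℂ) ∈ closedBall ((2 : ℂ) + ((0 : ℝ) : ℂ) * I) (31 / 16) := by
    intro b hb
    obtain ⟨hb0, hb1, -⟩ := hT b hb
    rw [hc2, mem_closedBall, dist_eq_norm, show (b : ℂ) - 2 = ((b - 2 : ℝ) : ℂ) by push_cast; ring,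
      Complex.norm_real, Real.norm_eq_abs, abs_le]
    constructor <;> linarith
  have hDb : ∀ b ∈ T, (k b : ℤ) ≤ D b := fun b hb ↦
    natCast_le_divisor_of_le_analyticOrderAt han (hbB b hb) (hT b hb).2.2
      (analyticOrderAt_dedekindZeta₁_ne_top b)
  have eb : ∀ b ∈ T, (((σ : ℂ) - b)⁻¹).re = 1 / (σ - b) := fun b _ ↦ by
    rw [show (σ : ℂ) - b = ((σ - b : ℝ) : ℂ) by push_cast; ring, ← Complex.ofReal_inv, Complex.ofReal_re,
      one_div]
  -- `Σ_{b ∈ T} k(b)/(σ-b) ≤ Re Σ_{u ∈ S} D(u)/(σ-u)`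
  have hsum_ge : ∑ b ∈ T, (k b : ℝ) / (σ - b) ≤ (∑ u ∈ S, (D u : ℂ) / ((σ : ℂ) - u)).re := by
    rw [Complex.re_sum]
    -- split `T` into the part with `k b = 0` (contributes 0) and the rest (inside `S`)
    have hle1 : ∑ b ∈ T, (k b : ℝ) / (σ - b) ≤ ∑ b ∈ T, (D (ι b) : ℝ) * (((σ : ℂ) - ι b)⁻¹).re := by
      refine Finset.sum_le_sum fun b hb ↦ ?_
      obtain ⟨hb0, hb1, -⟩ := hT b hb
      rw [hι]; dsimp only
      rw [eb b hb, div_eq_mul_one_div]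
      have hpos : 0 < 1 / (σ - b) := one_div_pos.mpr (by linarith)
      have : (k b : ℝ) ≤ D b := by exact_mod_cast hDb b hb
      nlinarith
    refine hle1.trans ?_
    rw [← Finset.sum_image (f := fun u ↦ (D u : ℝ) * (((σ : ℂ) - u)⁻¹).re) hιinj]
    have hsub' : ∀ u ∈ T.image ι, u ∉ S → (D u : ℝ) * (((σ : ℂ) - u)⁻¹).re ≤ 0 := by
      intro u _ huS
      have hDu : D u = 0 := by
        by_contra hne
        exact huS (by rw [hS, Set.Finite.mem_toFinset, Function.mem_support]; exact hne)
      rw [hDu]; simp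
    calc ∑ u ∈ T.image ι, (D u : ℝ) * (((σ : ℂ) - u)⁻¹).re
        = ∑ u ∈ (T.image ι).filter (fun u ↦ u ∈ S), (D u : ℝ) * (((σ : ℂ) - u)⁻¹).re +
            ∑ u ∈ (T.image ι).filter (fun u ↦ ¬ u ∈ S), (D u : ℝ) * (((σ : ℂ) - u)⁻¹).re :=
          (Finset.sum_filter_add_sum_filter_not _ _ _).symm
      _ ≤ ∑ u ∈ (T.image ι).filter (fun u ↦ u ∈ S), (D u : ℝ) * (((σ : ℂ) - u)⁻¹).re := by
          have : ∑ u ∈ (T.image ι).filter (fun u ↦ ¬ u ∈ S), (D u : ℝ) * (((σ : ℂ) - u)⁻¹).re ≤ 0 :=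
            Finset.sum_nonpos fun u hu ↦ by
              rw [Finset.mem_filter] at hu
              exact hsub' u hu.1 hu.2
          linarith
      _ ≤ ∑ u ∈ S, (D u : ℝ) * (((σ : ℂ) - u)⁻¹).re := by
          refine Finset.sum_le_sum_of_subset_of_nonneg (fun u hu ↦ (Finset.mem_filter.mp hu).2)
            fun u hu _ ↦ ?_
          rw [← hterm_re]; exact hterm_nn u hu
      _ = ∑ u ∈ S, ((D u : ℂ) / ((σ : ℂ) - u)).re := Finset.sum_congr rfl fun u _ ↦ (hterm_re u).symm
  -- assemble with the partial fraction
  have hL : LSeries (fun n ↦ (vonMangoldtNorm K n : ℂ)) σ =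
      1 / ((σ : ℂ) - 1) - (∑ u ∈ S, (D u : ℂ) / ((σ : ℂ) - u)) -
        (logDeriv f σ - ∑ u ∈ S, (D u : ℂ) / ((σ : ℂ) - u)) := by
    rw [logDeriv_dedekindZeta₁_eq hs]; ring
  have hre1 : (1 / ((σ : ℂ) - 1)).re = 1 / (σ - 1) := by
    rw [show (σ : ℂ) - 1 = ((σ - 1 : ℝ) : ℂ) by push_cast; ring, ← Complex.ofReal_one, ← Complex.ofReal_div,
      Complex.ofReal_re]
  rw [hL, Complex.sub_re, Complex.sub_re, hre1]
  have h1 := Complex.abs_re_le_norm (logDeriv f σ - ∑ u ∈ S, (D u : ℂ) / ((σ : ℂ) - u))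
  have h2 := neg_abs_le (logDeriv f σ - ∑ u ∈ S, (D u : ℂ) / ((σ : ℂ) - u)).re
  linarith

/-! ### At most one real zero of `ζ_K`, and it is simple -/

/-- The numeric constant `K' = 77760(5n + 2)` controls `77760 M_K(0) ≤ K'(log|d_K| + log 4)`. [folklore] -/
theorem discBound_zero_le' :
    77760 * discBound K 0 ≤ 77760 * (5 * Module.finrank ℚ K + 2) *
      (Real.log ((discr K).natAbs : ℝ) + Real.log 4) := by
  have := discBound_zero_le (K := K)
  nlinarith

/-- `1 ≤ log|d_K| + log 4`. [folklore] -/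
theorem one_le_log_discr_add_log_four : 1 ≤ Real.log ((discr K).natAbs : ℝ) + Real.log 4 := by
  have hd1 : (1 : ℝ) ≤ ((discr K).natAbs : ℝ) := by
    have h := Int.one_le_abs (NumberField.discr_ne_zero K)
    rw [Int.abs_eq_natAbs] at h
    exact_mod_cast h
  exact UniformTwistedZFRData.log_add_log_four_ge hd1

/-- **At most one real zero of `ζ_K` near `1`, uniformly in the field**: for every `n` there is
`c = c(n) > 0` such that for every `K` of degree `n`, two distinct real zeros `β₀ ≠ β₁` of `ζ₁_K`
(`= (s−1)ζ_K(s)`) satisfy `min(β₀, β₁) ≤ 1 − c/(log|d_K| + log 4)`: with `β = min` and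
`σ = 1 + 2(1 − β)`, `0 ≤ L(Λ_K, σ) ≤ 1/(σ−1) − 2/(σ−β) + K'ℒ₀`.
[cite: MontgomeryVaughan2007, Theorem 11.3 (proof, Case 4)] -/
theorem exists_min_realZeros_dedekindZeta₁_le (n : ℕ) :
    ∃ c : ℝ, 0 < c ∧ ∀ (K : Type) [Field K] [NumberField K], Module.finrank ℚ K = n →
      ∀ β₀ β₁ : ℝ, β₀ ≠ β₁ → dedekindZeta₁ K β₀ = 0 → dedekindZeta₁ K β₁ = 0 →
        min β₀ β₁ ≤ 1 - c / (Real.log ((discr K).natAbs : ℝ) + Real.log 4) := by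
  set Kc : ℝ := 77760 * (5 * n + 2) with hKc
  have hKc0 : 0 ≤ Kc := by positivity
  set c : ℝ := min (1 / 4) (1 / (6 * (Kc + 1))) with hcdef
  have hc : 0 < c := lt_min (by norm_num) (by positivity)
  have hc4 : c ≤ 1 / 4 := min_le_left _ _
  have hcK : c ≤ 1 / (6 * (Kc + 1)) := min_le_right _ _
  refine ⟨c, hc, fun K _ _ hK β₀ β₁ hne h₀ h₁ ↦ ?_⟩
  subst hK
  set ℒ₀ : ℝ := Real.log ((discr K).natAbs : ℝ) + Real.log 4 with hℒ₀
  have hℒ₀1 : 1 ≤ ℒ₀ := one_le_log_discr_add_log_four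
  have hℒ₀0 : 0 < ℒ₀ := by linarith
  have hcℒ : c / ℒ₀ ≤ c := div_le_self hc.le hℒ₀1
  wlog hle : β₀ ≤ β₁ generalizing β₀ β₁
  · rw [min_comm]; exact this β₁ β₀ hne.symm h₁ h₀ (le_of_not_ge hle)
  rw [min_eq_left hle]
  have hlt : β₀ < β₁ := lt_of_le_of_ne hle hne
  have hβ₁1 : β₁ < 1 := realZero_dedekindZeta₁_lt_one h₁
  set u : ℝ := 1 - β₀ with hu
  have hu0 : 0 < u := by rw [hu]; linarith
  by_contra hcon
  rw [not_le] at hcon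
  have hularge : u < c / ℒ₀ := by rw [hu]; linarith
  have husmall : u < 1 / 4 := by linarith
  set σ : ℝ := 1 + 2 * u with hσdef
  have hσ1 : 1 < σ := by rw [hσdef]; linarith
  have hσ2 : σ ≤ 2 := by rw [hσdef]; linarith
  -- orders ≥ 1 at both zeros
  have hord : ∀ b : ℝ, dedekindZeta₁ K b = 0 → ((1 : ℕ) : ℕ∞) ≤ analyticOrderAt (dedekindZeta₁ K) b := by
    intro b hb
    have hne0 : analyticOrderAt (dedekindZeta₁ K) b ≠ 0 := by
      rw [ne_eq, ((dedekindZeta₁_differentiable K).analyticAt _).analyticOrderAt_eq_zero, not_not]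
      exact hb
    exact Order.one_le_iff_ne_zero.mpr hne0
  have hT : ∀ b ∈ ({β₀, β₁} : Finset ℝ), 1 / 16 ≤ b ∧ b < 1 ∧
      (((fun _ ↦ 1 : ℝ → ℕ) b : ℕ) : ℕ∞) ≤ analyticOrderAt (dedekindZeta₁ K) b := by
    intro b hb
    rw [Finset.mem_insert, Finset.mem_singleton] at hb
    rcases hb with rfl | rfl
    · exact ⟨by linarith, by linarith, hord _ h₀⟩
    · exact ⟨by linarith, hβ₁1, hord _ h₁⟩
  have hA := re_LSeries_vonMangoldtNorm_ofReal_le_of_realZeros {β₀, β₁} (fun _ ↦ 1) hT hσ1 hσ2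
  rw [Finset.sum_pair hne] at hA
  simp only [Nat.cast_one] at hA
  have hpos : 0 ≤ (LSeries (fun m ↦ (vonMangoldtNorm K m : ℂ)) σ).re := by
    have h := TwistedZFR.norm_LSeries_le_of_norm_le (f := fun m ↦ (vonMangoldtNorm K m : ℂ))
      (Λ₀ := vonMangoldtNorm K) (fun m ↦ by
        rw [Complex.norm_real, Real.norm_of_nonneg (vonMangoldtNorm_nonneg m)])
      (fun s hs ↦ LSeriesSummable_vonMangoldtNorm hs) (s := (σ : ℂ)) hσ1 (by simp)
    exact (norm_nonneg _).trans h
  have hM := discBound_zero_le' (K := K)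
  have h1' : 1 / (σ - β₀) ≤ 1 / (σ - β₁) :=
    div_le_div_of_nonneg_left zero_le_one (by linarith) (by linarith)
  have hkey : 2 / (σ - β₀) - 1 / (σ - 1) ≤ Kc * ℒ₀ := by
    have e : 2 / (σ - β₀) = 1 / (σ - β₀) + 1 / (σ - β₀) := by ring
    rw [e, hKc]
    linarith
  have hval : 2 / (σ - β₀) - 1 / (σ - 1) = 1 / (6 * u) := by
    have e1 : σ - β₀ = 3 * u := by rw [hσdef, hu]; ring
    have e2 : σ - 1 = 2 * u := by rw [hσdef]; ring
    have hu' : u ≠ 0 := hu0.ne'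
    rw [e1, e2]; field_simp; norm_num
  rw [hval] at hkey
  have hc' : c * (6 * (Kc + 1)) ≤ 1 := by
    rw [le_div_iff₀ (by positivity)] at hcK; linarith
  have hfinal : c / ℒ₀ ≤ u := by
    rw [div_le_iff₀ hℒ₀0]
    rw [div_le_iff₀ (by positivity)] at hkey
    nlinarith
  linarith

/-- **A real zero of `ζ_K` near `1` is simple, uniformly in the field**: for every `n` there is
`c = c(n) > 0` such that for every `K` of degree `n`, a real `β` with `ord_β ζ₁_K ≥ 2` satisfies
`β ≤ 1 − c/(log|d_K| + log 4)`. [cite: MontgomeryVaughan2007, Theorem 11.3] -/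
theorem exists_realZero_simple_dedekindZeta₁ (n : ℕ) :
    ∃ c : ℝ, 0 < c ∧ ∀ (K : Type) [Field K] [NumberField K], Module.finrank ℚ K = n →
      ∀ β : ℝ, (2 : ℕ∞) ≤ analyticOrderAt (dedekindZeta₁ K) β →
        β ≤ 1 - c / (Real.log ((discr K).natAbs : ℝ) + Real.log 4) := by
  set Kc : ℝ := 77760 * (5 * n + 2) with hKc
  have hKc0 : 0 ≤ Kc := by positivity
  set c : ℝ := min (1 / 4) (1 / (6 * (Kc + 1))) with hcdef
  have hc : 0 < c := lt_min (by norm_num) (by positivity)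
  have hc4 : c ≤ 1 / 4 := min_le_left _ _
  have hcK : c ≤ 1 / (6 * (Kc + 1)) := min_le_right _ _
  refine ⟨c, hc, fun K _ _ hK β hord ↦ ?_⟩
  subst hK
  set ℒ₀ : ℝ := Real.log ((discr K).natAbs : ℝ) + Real.log 4 with hℒ₀
  have hℒ₀1 : 1 ≤ ℒ₀ := one_le_log_discr_add_log_four
  have hℒ₀0 : 0 < ℒ₀ := by linarith
  have hcℒ : c / ℒ₀ ≤ c := div_le_self hc.le hℒ₀1
  have hzero : dedekindZeta₁ K β = 0 := by
    have : analyticOrderAt (dedekindZeta₁ K) β ≠ 0 := by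
      intro h; rw [h] at hord; exact absurd hord (by decide)
    rwa [ne_eq, ((dedekindZeta₁_differentiable K).analyticAt _).analyticOrderAt_eq_zero, not_not] at this
  have hβ1 : β < 1 := realZero_dedekindZeta₁_lt_one hzero
  set u : ℝ := 1 - β with hu
  have hu0 : 0 < u := by rw [hu]; linarith
  by_contra hcon
  rw [not_le] at hcon
  have hularge : u < c / ℒ₀ := by rw [hu]; linarith
  have husmall : u < 1 / 4 := by linarith
  set σ : ℝ := 1 + 2 * u with hσdef
  have hσ1 : 1 < σ := by rw [hσdef]; linarith
  have hσ2 : σ ≤ 2 := by rw [hσdef]; linarith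
  have hT : ∀ b ∈ ({β} : Finset ℝ), 1 / 16 ≤ b ∧ b < 1 ∧
      (((fun _ ↦ 2 : ℝ → ℕ) b : ℕ) : ℕ∞) ≤ analyticOrderAt (dedekindZeta₁ K) b := by
    intro b hb
    rw [Finset.mem_singleton] at hb
    subst hb
    exact ⟨by linarith, hβ1, by exact_mod_cast hord⟩
  have hA := re_LSeries_vonMangoldtNorm_ofReal_le_of_realZeros {β} (fun _ ↦ 2) hT hσ1 hσ2
  rw [Finset.sum_singleton] at hA
  simp only [Nat.cast_ofNat] at hA
  have hpos : 0 ≤ (LSeries (fun m ↦ (vonMangoldtNorm K m : ℂ)) σ).re := by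
    have h := TwistedZFR.norm_LSeries_le_of_norm_le (f := fun m ↦ (vonMangoldtNorm K m : ℂ))
      (Λ₀ := vonMangoldtNorm K) (fun m ↦ by
        rw [Complex.norm_real, Real.norm_of_nonneg (vonMangoldtNorm_nonneg m)])
      (fun s hs ↦ LSeriesSummable_vonMangoldtNorm hs) (s := (σ : ℂ)) hσ1 (by simp)
    exact (norm_nonneg _).trans h
  have hM := discBound_zero_le' (K := K)
  have hkey : 2 / (σ - β) - 1 / (σ - 1) ≤ Kc * ℒ₀ := by rw [hKc]; linarith
  have hval : 2 / (σ - β) - 1 / (σ - 1) = 1 / (6 * u) := by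
    have e1 : σ - β = 3 * u := by rw [hσdef, hu]; ring
    have e2 : σ - 1 = 2 * u := by rw [hσdef]; ring
    have hu' : u ≠ 0 := hu0.ne'
    rw [e1, e2]; field_simp; norm_num
  rw [hval] at hkey
  have hc' : c * (6 * (Kc + 1)) ≤ 1 := by
    rw [le_div_iff₀ (by positivity)] at hcK; linarith
  have hfinal : c / ℒ₀ ≤ u := by
    rw [div_le_iff₀ hℒ₀0]
    rw [div_le_iff₀ (by positivity)] at hkey
    nlinarith
  linarith

/-! ### Landau–Page across the family: `ζ_K` and `L(s, χ)` -/

/-- **Landau–Page for `ζ_K` against `L(s, χ)`, uniformly in the field** (MV Theorem 11.7 for the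
pair `(1, χ)`): for every `n` there is `c = c(n) > 0` such that for every `K` of degree `n`, every
class group character `χ ≠ 1`, every real zero `β₀` of `ζ₁_K` and every real zero `β` of
`L₀(s, χ)`, `min(β₀, β) ≤ 1 − c/(log|d_K| + log 4)`: MV (11.4)
`0 ≤ L(Λ_K, σ) + Re L(Λ_χ, σ)` with `L(Λ_K, σ) ≤ 1/(σ−1) − 1/(σ−β₀) + K'ℒ₀` (partial fraction of
`ζ₁_K`) and `Re L(Λ_χ, σ) ≤ Eℒ₀ − 1/(σ−β)` (MV (11.2)) at `σ = 1 + 2(1 − min)`.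
[cite: MontgomeryVaughan2007, Theorem 11.7] -/
theorem exists_landau_dedekindZeta₁_classGroupLFunction₀ (n : ℕ) :
    ∃ c : ℝ, 0 < c ∧ ∀ (K : Type) [Field K] [NumberField K], Module.finrank ℚ K = n →
      ∀ χ : ClassGroup (𝓞 K) →* ℂˣ, χ ≠ 1 → ∀ β₀ β : ℝ,
        dedekindZeta₁ K β₀ = 0 → classGroupLFunction₀ K χ β = 0 →
          min β₀ β ≤ 1 - c / (Real.log ((discr K).natAbs : ℝ) + Real.log 4) := by
  obtain ⟨hA0, -, -, hK₀, -⟩ := zfrParams_nonneg n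
  set A : ℝ := (n : ℝ) + 1 with hAdef
  set Cg : ℝ := 2 * Real.exp (2 * n) * (3 / 2) ^ (n + 1) with hCg
  set c₁ : ℝ := 32 * Real.exp (-(32 * n)) with hc₁
  set Kc : ℝ := 77760 * (5 * n + 2) with hKc
  set E : ℝ := 8 * (2 * A + |Real.log (Cg / (c₁ * ((1 : ℝ) / 32)))| + 1) / ((1 : ℝ) / 4) with hE
  have hE0 : 0 ≤ E := by rw [hE]; positivity
  have hKc0 : 0 ≤ Kc := by positivity
  set c : ℝ := min (3 * (1 : ℝ) / 64) (1 / (6 * (Kc + E + 1))) with hcdef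
  have hc : 0 < c := lt_min (by norm_num) (by positivity)
  have hcη : c ≤ 3 / 64 := by have := min_le_left (3 * (1 : ℝ) / 64) (1 / (6 * (Kc + E + 1))); linarith
  have hcK : c ≤ 1 / (6 * (Kc + E + 1)) := min_le_right _ _
  refine ⟨c, hc, fun K _ _ hK χ hχ β₀ β hz₀ hz ↦ ?_⟩
  subst hK
  set ℒ₀ : ℝ := Real.log ((discr K).natAbs : ℝ) + Real.log 4 with hℒ₀
  have hℒ₀1 : 1 ≤ ℒ₀ := one_le_log_discr_add_log_four
  have hℒ₀0 : 0 < ℒ₀ := by linarith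
  have hcℒ : c / ℒ₀ ≤ c := div_le_self hc.le hℒ₀1
  have hβ₀1 : β₀ < 1 := realZero_dedekindZeta₁_lt_one hz₀
  have hβ1 : β < 1 := realZero_lt_one hχ hz
  set u : ℝ := 1 - min β₀ β with hu
  have hu0 : 0 < u := by
    rw [hu]; have := min_le_left β₀ β; linarith
  by_contra hcon
  rw [not_le] at hcon
  have hularge : u < c / ℒ₀ := by rw [hu]; linarith
  have husmall : u < 3 / 64 := by linarith
  have hβ₀u : 1 - β₀ ≤ u := by rw [hu]; have := min_le_left β₀ β; linarith
  have hβu : 1 - β ≤ u := by rw [hu]; have := min_le_right β₀ β; linarith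
  set σ : ℝ := 1 + 2 * u with hσdef
  have hσ1 : 1 < σ := by rw [hσdef]; linarith
  have hσ2 : σ ≤ 2 := by rw [hσdef]; linarith
  set d : ℝ := 2 * u with hddef
  have hdpos : 0 < d := by positivity
  have hd1 : d ≤ 3 * (1 : ℝ) / 32 := by rw [hddef]; linarith
  have hσd : σ = 1 + d := by rw [hσdef, hddef]
  -- (1) `L(Λ_K, σ) ≤ 1/(σ−1) − 1/(σ−β₀) + K'ℒ₀`
  have hord₀ : ((1 : ℕ) : ℕ∞) ≤ analyticOrderAt (dedekindZeta₁ K) β₀ := by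
    have hne0 : analyticOrderAt (dedekindZeta₁ K) β₀ ≠ 0 := by
      rw [ne_eq, ((dedekindZeta₁_differentiable K).analyticAt _).analyticOrderAt_eq_zero, not_not]
      exact hz₀
    exact Order.one_le_iff_ne_zero.mpr hne0
  have hT : ∀ b ∈ ({β₀} : Finset ℝ), 1 / 16 ≤ b ∧ b < 1 ∧
      (((fun _ ↦ 1 : ℝ → ℕ) b : ℕ) : ℕ∞) ≤ analyticOrderAt (dedekindZeta₁ K) b := by
    intro b hb
    rw [Finset.mem_singleton] at hb
    subst hb
    exact ⟨by linarith, hβ₀1, hord₀⟩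
  have hA := re_LSeries_vonMangoldtNorm_ofReal_le_of_realZeros {β₀} (fun _ ↦ 1) hT hσ1 hσ2
  rw [Finset.sum_singleton] at hA
  simp only [Nat.cast_one] at hA
  have hM := discBound_zero_le' (K := K)
  -- (2) `Re L(Λ_χ, σ) ≤ Eℒ₀ − 1/(σ−β)` from the datum of `χ`
  have hB : (LSeries (twistVonMangoldt K (classGroupCharIdealHom χ)) (((1 + d : ℝ) : ℂ))).re ≤
      E * ℒ₀ - 1 / (1 + d - β) := by
    have hb : 1 - 7 * (1 : ℝ) / 32 ≤ β := by linarith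
    by_cases h2 : χ * χ = 1
    · have hdat := uniformTwistedZFRData_classGroupLFunction₀_of_eq hχ h2
      have hpack := hdat.exists_package
      have := hdat.re_LSeries₁_ofReal_le_of_realZero hpack hz hb hdpos hd1
      exact this
    · have hdat := uniformTwistedZFRData_classGroupLFunction₀_of_ne h2
      have hpack := hdat.exists_package
      have := hdat.re_LSeries₁_ofReal_le_of_realZero hpack hz hb hdpos hd1
      exact this
  rw [← hσd] at hB
  -- (3) MV (11.4)
  have h114 := TwistedZFR.re_add_re_nonneg (norm_twistVonMangoldt_le (norm_classGroupCharIdealHom_le χ))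
    (fun s hs ↦ LSeriesSummable_vonMangoldtNorm hs) hσ1
  -- combine: both zero terms are `≥ 1/(3u)`
  have e₀ : 1 / (3 * u) ≤ 1 / (σ - β₀) :=
    div_le_div_of_nonneg_left zero_le_one (by linarith) (by rw [hσdef]; linarith)
  have e₁ : 1 / (3 * u) ≤ 1 / (σ - β) :=
    div_le_div_of_nonneg_left zero_le_one (by linarith) (by rw [hσdef]; linarith)
  have hkey : 2 / (3 * u) - 1 / (σ - 1) ≤ (Kc + E) * ℒ₀ := by
    have e : 2 / (3 * u) = 1 / (3 * u) + 1 / (3 * u) := by ring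
    rw [e, hKc]
    linarith
  have hval : 2 / (3 * u) - 1 / (σ - 1) = 1 / (6 * u) := by
    have e2 : σ - 1 = 2 * u := by rw [hσdef]; ring
    have hu' : u ≠ 0 := hu0.ne'
    rw [e2]; field_simp; norm_num
  rw [hval] at hkey
  have hc' : c * (6 * (Kc + E + 1)) ≤ 1 := by
    rw [le_div_iff₀ (by positivity)] at hcK; linarith
  have hfinal : c / ℒ₀ ≤ u := by
    rw [div_le_iff₀ hℒ₀0]
    rw [div_le_iff₀ (by positivity)] at hkey
    nlinarith
  linarith

end Literature.NumberTheory.LFunctions.NumberField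

end
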